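import Literature.AlgebraicGeometry.AbelianSchemes.AbelianSchemeOverZariskiGluingPolarization
import Literature.AlgebraicGeometry.AbelianSchemes.AbelianSchemeSymplecticLevelTransfer
import Literature.AlgebraicGeometry.AbelianSchemes.AbelianSchemeFibreHom
import HarnessLib

/-!
# The fibrewise clauses `HasType δ` and `IsSymplecticLiftable` glue along a Zariski gluing datum

Layer `Literature/AlgebraicGeometry/AbelianSchemes`, namespace `Literature.AlgebraicGeometry.AbelianSchemes.AbelianSchemeOver`.
THEOREMS ONLY.  Cell `hodgecm-mathlib` (D-0151), (h7) «Zariski gluing of `S`-objects from a cocycle», layer (P2) over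
(P1) `AbelianSchemeOverZariskiGluingPolarization` (the glued polarisation `PolarizationDatum.polarization`) and FILE 4
`AbelianSchemeOverZariskiGluingLevel` (the glued level structure `ZariskiGluingDatum.levelStructure`); count-neutral
Literature capital.  HC_CM is proved only modulo the 7 printed citations until rung 0 closes.

The two remaining clauses of a triple `(A, λ, φ)` of [MumfordFogartyKirwan1994, Def. 7.2] — the TYPE `δ` of `λ`
(App. 7A: `ker λ̄_s ≅ (∏ ℤ/δᵢ)²` at geometric points) and the SYMPLECTIC-LIFTABILITY of `φ` for `λ`
([Lan2013PELCompactifications, Def. 1.3.6.2, Lemma 1.3.6.6]) — are statements about GEOMETRIC FIBRES, hence glue: a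
geometric point `s` of `S` factors through a chart `Uᵢ` (`exists_fac`), and the fibre of the chart `Aᵢ` at `s′` IS the
fibre of the glued `Z` at `s′ ≫ (Uᵢ → S)` ((P1) `fibreChartIso`).  What has to be checked is that the clauses transport
UP along a cartesian chart square `(G, Ĝ) : (A′, Â′)/S′ → (A, Â)/S` with its `λ`-clause `λ′ ≫ Ĝ = G ≫ λ` and a
fibre isomorphism `e : A′_{s′} ≅ A_{s′ ≫ f}` over `G`:

* §1 `map_fibreIso_one`, `map_fibreIso_inv_map`, `map_fibreIso_map_inv` — points along `e` and `e⁻¹`.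
* §2 **`mem_kerPointsAt_map_fibreIso_iff`** — `e(P′) ∈ K(λ̄)` iff `P′ ∈ K(λ̄′)`: `λ̄(eP′) = λ̄′(P′) ≫ Ĝ`
  (★ `valueAt_map_fibreIso_eq`) and `Ĝ` is injective on points over `s′` (cartesian square).
* §3 **`exists_mulHom_kerPointsAt_of_fibreIso`** — the App. 7A clause `ker λ̄′_{s′} ≅ (∏ ℤ/δᵢ)²` transports to
  `ker λ̄_{s′ ≫ f}` through the group isomorphism on points induced by `e`.
* §4 **`map_fibreIso_restrictPt`**, `map_fibreIso_inv_restrictPt` — `e(σ′ₖ(s′)) = σₖ(s′ ≫ f)` for level structures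
  related by `LevelStructure.IsBaseChangeVia` (`σ′ₖ ≫ G = f ≫ σₖ`).
* §5 **`nonempty_symplecticLift_of_fibreIso`** — symplectic lifts at `s′` for `λ′` give symplectic lifts at
  `s′ ≫ f` for `λ`: `Θ ↦ e^*Θ` keeps ampleness and `λ̄ = Λ(𝒪(Θ))` (★ `IsLambdaOfAt.of_isBaseChangeVia_fibreIso`, using
  the Poincaré clause), the chart lift transports back along `e⁻¹` (★ `SymplecticLift.nonempty_transport`), and
  `(e⁻¹)^*e^*Θ ~ Θ` (★ `nonempty_of_linEquiv`).
* §6 THE GLUED CLAUSES: **`PolarizationDatum.hasType_polarization`** and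
  **`PolarizationDatum.isSymplecticLiftable_levelStructure`**.

## References
* [MumfordFogartyKirwan1994] D. Mumford, J. Fogarty, F. Kirwan, *Geometric Invariant Theory* (3rd ed., 1994), Ch. 6 §2
  Definition 6.2–6.3 (p. 120); Ch. 7 §2 Definition 7.2 (p. 129); App. 7A (pp. 234–235).
* [Lan2013PELCompactifications] K.-W. Lan, *Arithmetic compactifications of PEL-type Shimura varieties* (2013), §1.3.6
  Lemma 1.3.6.5 (p. 81), Lemma 1.3.6.6 (pp. 81–82).
* [MumfordAV1970] D. Mumford, *Abelian Varieties* (1970), §13 (the group K(L)); §20 (p. 186).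
* [GortzWedhorn2020] U. Görtz, T. Wedhorn, *Algebraic Geometry I* (2nd ed., 2020), Section (3.3) Proposition 3.5;
  Section (4.7) (pp. 107–108).
-/

noncomputable section

universe u

open CategoryTheory CategoryTheory.Limits AlgebraicGeometry MonoidalCategory

namespace Literature.AlgebraicGeometry.AbelianSchemes

namespace AbelianSchemeOver

open Literature.AlgebraicGeometry.Motives Literature.AlgebraicGeometry.AbelianVarieties
open Literature.AlgebraicGeometry.ModuliOfAbelianVarieties (IsPolarizationType)
open scoped MonObj

section Square

variable {S S' : Scheme.{u}} (A : AbelianSchemeOver S) (A' : AbelianSchemeOver S') (f : S' ⟶ S)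
  (G : A'.X.left ⟶ A.X.left) {Ω : Type u} [Field Ω] (s' : Spec (.of Ω) ⟶ S')
  (e : (A'.fibre s').toAbelianVariety ≅ (A.fibre (s' ≫ f)).toAbelianVariety)
  (he : AbelianVariety.Hom.toSchemeHom e.hom ≫ pullback.fst A.X.hom (s' ≫ f) = pullback.fst A'.X.hom s' ≫ G)

/-! ### §1 Points along a fibre isomorphism -/

/-- `e(1) = 1` on `Ω`-points (`e` is a homomorphism of group schemes). [cite: MumfordAV1970, §4 (rational points)] -/
theorem map_fibreIso_one :
    AlgPoints.map e.hom.hom.hom.hom (1 : (A'.fibre s').toAbelianVariety.Points Ω) = 1 :=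
  MonObj.one_comp _

/-- `e⁻¹(e(P′)) = P′` on `Ω`-points. [cite: MumfordAV1970, §4 (rational points)] -/
theorem map_fibreIso_inv_map (P' : (A'.fibre s').toAbelianVariety.Points Ω) :
    AlgPoints.map e.inv.hom.hom.hom (AlgPoints.map e.hom.hom.hom.hom P') = P' := by
  rw [← AlgPoints.map_comp_apply]
  change AlgPoints.map (e.hom ≫ e.inv).hom.hom.hom P' = P'
  rw [e.hom_inv_id]
  exact AlgPoints.map_id_apply P'

/-- `e(e⁻¹(Q)) = Q` on `Ω`-points. [cite: MumfordAV1970, §4 (rational points)] -/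
theorem map_fibreIso_map_inv (Q : (A.fibre (s' ≫ f)).toAbelianVariety.Points Ω) :
    AlgPoints.map e.hom.hom.hom.hom (AlgPoints.map e.inv.hom.hom.hom Q) = Q := by
  rw [← AlgPoints.map_comp_apply]
  change AlgPoints.map (e.inv ≫ e.hom).hom.hom.hom Q = Q
  rw [e.inv_hom_id]
  exact AlgPoints.map_id_apply Q

/-! ### §2 Kernels of `λ̄` on points along a cartesian chart square -/

variable {D : A.DualPair} (pol : A.Polarization D) {D' : A'.DualPair} (pol' : A'.Polarization D')
  (Ĝ : D'.hat.X.left ⟶ D.hat.X.left) (hĜ : IsPullback Ĝ D'.hat.X.hom D.hat.X.hom f)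
  (hlam : pol'.lam.left ≫ Ĝ = G ≫ pol.lam.left)

include hĜ in
/-- `Ĝ` is injective on `Ω`-points of `Â′` over `s′` (the square `(Ĝ, f)` is cartesian).
[cite: GortzWedhorn2020, Section (4.7) (pp. 107–108)] -/
theorem valueAt_comp_eq_iff_of_isPullback (P' Q' : (A'.fibre s').toAbelianVariety.Points Ω) :
    pol'.valueAt s' P' ≫ Ĝ = pol'.valueAt s' Q' ≫ Ĝ ↔ pol'.valueAt s' P' = pol'.valueAt s' Q' := by
  refine ⟨fun h => hĜ.hom_ext h ?_, fun h => by rw [h]⟩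
  rw [Polarization.valueAt, Polarization.valueAt, valueAt_comp_hom, valueAt_comp_hom]

include he hĜ hlam in
/-- **`e(P′) ∈ K(λ̄_{s′ ≫ f})` iff `P′ ∈ K(λ̄′_{s′})`**: `λ̄(eP′) = λ̄′(P′) ≫ Ĝ` (★ `valueAt_map_fibreIso_eq`), `e(1) = 1`,
and `Ĝ` is injective on points over `s′`. [cite: MumfordAV1970, §13 (the group K(L))] [cite: MumfordFogartyKirwan1994, App. 7A (pp. 234–235)] -/
theorem mem_kerPointsAt_map_fibreIso_iff (P' : (A'.fibre s').toAbelianVariety.Points Ω) :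
    AlgPoints.map e.hom.hom.hom.hom P' ∈ pol.kerPointsAt (s' ≫ f) ↔ P' ∈ pol'.kerPointsAt s' := by
  rw [Polarization.mem_kerPointsAt_iff, Polarization.mem_kerPointsAt_iff, ← A.map_fibreIso_one A' f s' e,
    Polarization.valueAt, Polarization.valueAt,
    valueAt_map_fibreIso_eq (A := A) (D := D) (lam := pol.lam) (A' := A') (D' := D') (lam' := pol'.lam) (f := f)
      (G := G) (Ĝ := Ĝ) (hlam := hlam) (s' := s') (e := e) (he := he) P',
    valueAt_map_fibreIso_eq (A := A) (D := D) (lam := pol.lam) (A' := A') (D' := D') (lam' := pol'.lam) (f := f)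
      (G := G) (Ĝ := Ĝ) (hlam := hlam) (s' := s') (e := e) (he := he) 1]
  exact A.valueAt_comp_eq_iff_of_isPullback A' f s' pol' Ĝ hĜ P' 1

/-! ### §3 The type clause transports up -/

include he hĜ hlam in
/-- **The App. 7A clause transports UP along a cartesian chart square**: if `ker λ̄′_{s′}` on `Ω`-points is the
image of an injective homomorphism from `(∏ ℤ/δᵢ)²`, then so is `ker λ̄_{s′ ≫ f}` — compose with the group
isomorphism on points induced by `e` (§2 identifies the kernels). [cite: MumfordFogartyKirwan1994, App. 7A (pp. 234–235)]
[cite: MumfordAV1970, §13 (the group K(L))] -/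
theorem exists_mulHom_kerPointsAt_of_fibreIso {g : ℕ} {δ : Fin g → ℕ}
    (h' : ∃ φ' : Multiplicative (((i : Fin g) → ZMod (δ i)) × ((i : Fin g) → ZMod (δ i))) →*
        (A'.fibre s').toAbelianVariety.Points Ω,
      Function.Injective φ' ∧ Set.range φ' = pol'.kerPointsAt s') :
    ∃ φ : Multiplicative (((i : Fin g) → ZMod (δ i)) × ((i : Fin g) → ZMod (δ i))) →*
        (A.fibre (s' ≫ f)).toAbelianVariety.Points Ω,
      Function.Injective φ ∧ Set.range φ = pol.kerPointsAt (s' ≫ f) := by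
  obtain ⟨φ', hinj, hrange⟩ := h'
  let fwd : (A'.fibre s').toAbelianVariety.Points Ω →* (A.fibre (s' ≫ f)).toAbelianVariety.Points Ω :=
    IsMonHom.monoidHom e.hom.hom.hom.hom (specOver Ω Ω)
  have hfwd : ∀ P, fwd P = AlgPoints.map e.hom.hom.hom.hom P := fun P => rfl
  refine ⟨fwd.comp φ', fun x y hxy => hinj ?_, ?_⟩
  · have h := congrArg (AlgPoints.map e.inv.hom.hom.hom) hxy
    simp only [MonoidHom.comp_apply, hfwd, A.map_fibreIso_inv_map A' f s' e] at h
    exact h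
  · ext Q
    constructor
    · rintro ⟨x, rfl⟩
      rw [MonoidHom.comp_apply, hfwd, A.mem_kerPointsAt_map_fibreIso_iff A' f G s' e he pol pol' Ĝ hĜ hlam, ← hrange]
      exact ⟨x, rfl⟩
    · intro hQ
      rw [← A.map_fibreIso_map_inv A' f s' e Q,
        A.mem_kerPointsAt_map_fibreIso_iff A' f G s' e he pol pol' Ĝ hĜ hlam, ← hrange] at hQ
      obtain ⟨x, hx⟩ := hQ
      exact ⟨x, by rw [MonoidHom.comp_apply, hfwd, hx, A.map_fibreIso_map_inv A' f s' e Q]⟩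

/-! ### §4 Sections of level structures along the fibre isomorphism -/

variable {g N : ℕ} (φ : A.LevelStructure g N) (φ' : A'.LevelStructure g N)
  (hφ : ∀ k, (φ'.σ k).left ≫ G = f ≫ (φ.σ k).left)

include he hφ in
/-- **`e(σ′ₖ(s′)) = σₖ(s′ ≫ f)`**: the fibre isomorphism over `G` carries the points of the sections of `φ′` at `s′` to
those of `φ` at `s′ ≫ f`, for level structures with `σ′ₖ ≫ G = f ≫ σₖ` (the section clause of ★
`LevelStructure.IsBaseChangeVia`; points of `A_{s′ ≫ f}` are determined by their image in `A`, ★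
`fibrePointToLeft_injective`). [cite: MumfordFogartyKirwan1994, Ch. 7 §2 Definition 7.1 (p. 129)] [cite: MumfordFogartyKirwan1994, Ch. 7 §2 Definition 7.2 (p. 129)] -/
theorem map_fibreIso_restrictPt (k : Fin g ⊕ Fin g) :
    AlgPoints.map e.hom.hom.hom.hom (A'.restrictPt s' (φ'.σ k)) = A.restrictPt (s' ≫ f) (φ.σ k) := by
  apply A.fibrePointToLeft_injective (s' ≫ f)
  rw [A.fibrePointToLeft_map_fibreIso_eq A' f G s' e he]
  have h1 : A'.fibrePointToLeft s' (A'.restrictPt s' (φ'.σ k)) = s' ≫ (φ'.σ k).left :=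
    A'.restrictPt_left_fst s' (φ'.σ k)
  have h2 : A.fibrePointToLeft (s' ≫ f) (A.restrictPt (s' ≫ f) (φ.σ k)) = (s' ≫ f) ≫ (φ.σ k).left :=
    A.restrictPt_left_fst (s' ≫ f) (φ.σ k)
  rw [h1, h2]
  exact (Category.assoc _ _ _).trans ((congrArg (s' ≫ ·) (hφ k)).trans (Category.assoc _ _ _).symm)

include he hφ in
/-- `e⁻¹(σₖ(s′ ≫ f)) = σ′ₖ(s′)` (the `he` clause of ★ `SymplecticLift.nonempty_transport` for `e⁻¹`).
[cite: MumfordFogartyKirwan1994, Ch. 7 §2 Definition 7.1 (p. 129)] [cite: MumfordFogartyKirwan1994, Ch. 7 §2 Definition 7.2 (p. 129)] -/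
theorem map_fibreIso_inv_restrictPt (k : Fin g ⊕ Fin g) :
    AlgPoints.map e.symm.hom.hom.hom.hom (A.restrictPt (s' ≫ f) (φ.σ k)) = A'.restrictPt s' (φ'.σ k) := by
  rw [← A.map_fibreIso_restrictPt A' f G s' e he φ φ' hφ k]
  exact A.map_fibreIso_inv_map A' f s' e _

/-! ### §5 Symplectic lifts transport up -/

include he hφ hlam in
/-- **Symplectic lifts transport UP along a cartesian chart square with its Poincaré clause**: if `φ′` is
symplectic-liftable for `λ′` then, at `s′ ≫ f`, every ample `Θ` with `λ̄ = Λ(𝒪(Θ))` admits a symplectic lift of `φ` —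
`e^*Θ` is ample with `λ̄′ = Λ(𝒪(e^*Θ))` at `s′` (★ `IsLambdaOfAt.of_isBaseChangeVia_fibreIso`), a lift of `φ′` for
`e^*Θ` transports along `e⁻¹` (★ `SymplecticLift.nonempty_transport`, [Lan2013] Lemma 1.3.6.5 speaks of the
geometric fibre only), and `(e⁻¹)^*e^*Θ ~ Θ` (★ `nonempty_of_linEquiv`).
[cite: Lan2013PELCompactifications, §1.3.6 Lemma 1.3.6.5 (p. 81) and Lemma 1.3.6.6 (pp. 81–82)] [cite: MumfordFogartyKirwan1994, Ch. 7 §2 Definition 7.2 (p. 129)] -/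
theorem nonempty_symplecticLift_of_fibreIso [IsAlgClosed Ω] {δ : Fin g → ℕ}
    (wG : A'.X.hom ≫ f = G ≫ A.X.hom) (wĜ : D'.hat.X.hom ≫ f = Ĝ ≫ D.hat.X.hom)
    (eP : Nonempty ((Scheme.Modules.pullback
      (pullback.map A'.X.hom D'.hat.X.hom A.X.hom D.hat.X.hom G Ĝ f wG wĜ)).obj D.P ≅ D'.P))
    (hsym' : φ'.IsSymplecticLiftable pol' δ)
    (Θ : CartierDivisor (A.fibre (s' ≫ f)).toAbelianVariety.X.left) (hΘ : Θ.IsAmple)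
    (hΛ : A.IsLambdaOfAt (s' ≫ f) D pol.lam Θ) : Nonempty (φ.SymplecticLift (s' ≫ f) Θ δ) := by
  obtain ⟨eP⟩ := eP
  haveI h₁ := AbelianVariety.isDominant_toSchemeHom_iso_hom e
  haveI h₂ : IsDominant (AbelianVariety.Hom.toSchemeHom e.symm.hom) :=
    AbelianVariety.isDominant_toSchemeHom_iso_hom e.symm
  haveI : IsIso (AbelianVariety.Hom.toSchemeHom e.hom) :=
    ⟨AbelianVariety.Hom.toSchemeHom e.inv,
      by change AbelianVariety.Hom.toSchemeHom (e.hom ≫ e.inv) = _; rw [e.hom_inv_id]; rfl,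
      by change AbelianVariety.Hom.toSchemeHom (e.inv ≫ e.hom) = _; rw [e.inv_hom_id]; rfl⟩
  -- `e^*Θ` is ample with `λ̄′ = Λ(𝒪(e^*Θ))` at `s′`
  have hΘ' : (Θ.pullback (AbelianVariety.Hom.toSchemeHom e.hom)).IsAmple := hΘ.pullback _
  have hΛ' : A'.IsLambdaOfAt s' D' pol'.lam (Θ.pullback (AbelianVariety.Hom.toSchemeHom e.hom)) :=
    IsLambdaOfAt.of_isBaseChangeVia_fibreIso A D pol.lam A' D' pol'.lam f G Ĝ wG wĜ hlam s' e he eP Θ hΛ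
  obtain ⟨Λ'⟩ := hsym' Ω s' _ hΘ' hΛ'
  -- transport the chart lift back along `e⁻¹`
  obtain ⟨Λ⟩ := Λ'.nonempty_transport (φ' := φ) e.symm (A.map_fibreIso_inv_restrictPt A' f G s' e he φ φ' hφ)
  -- `(e⁻¹)^*e^*Θ` is the same divisor as `Θ`
  have hsame : ((Θ.pullback (AbelianVariety.Hom.toSchemeHom e.hom)).pullback
      (AbelianVariety.Hom.toSchemeHom e.symm.hom)).SameDivisor Θ := by
    refine (Θ.pullback_pullback_sameDivisor _ _).trans ?_
    have hcomp : AbelianVariety.Hom.toSchemeHom e.symm.hom ≫ AbelianVariety.Hom.toSchemeHom e.hom = 𝟙 _ := by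
      change AbelianVariety.Hom.toSchemeHom (e.inv ≫ e.hom) = _
      rw [e.inv_hom_id]
      rfl
    exact (Θ.pullback_congr_sameDivisor hcomp).trans Θ.pullback_id_sameDivisor
  exact Λ.nonempty_of_linEquiv hsame.linEquiv

end Square

/-! ### §6 The glued clauses -/

namespace ZariskiGluingDatum

namespace PolarizationDatum

variable {S : Scheme.{u}} {𝔇 : ZariskiGluingDatum S} {D₀ : 𝔇.abelianScheme.DualPair} (𝔓 : PolarizationDatum 𝔇 D₀)

/-- **The glued polarisation has TYPE `δ` if every chart polarisation has**: at a geometric point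
`s = s′ ≫ (Uᵢ → S)` (FILE 4 `exists_fac`) the App. 7A clause of `λᵢ` at `s′` transports up along the chart square
`(χᵢ, Ĝᵢ)` through (P1) `fibreChartIso` (§3).  (`IsPolarizationType δ` is a hypothesis: the cover may be empty.)
[cite: MumfordFogartyKirwan1994, App. 7A (pp. 234–235)] -/
theorem hasType_polarization {g : ℕ} {δ : Fin g → ℕ} (hδ : IsPolarizationType δ)
    (hT : ∀ i, (𝔓.pol i).HasType δ) : 𝔓.polarization.HasType δ := by
  refine ⟨hδ, fun Ω _ _ s => ?_⟩
  obtain ⟨i, s', rfl⟩ := 𝔇.exists_fac s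
  exact 𝔇.abelianScheme.exists_mulHom_kerPointsAt_of_fibreIso (𝔇.A i) (𝔇.𝒰.f i) (𝔇.χ i) s'
    (𝔇.fibreChartIso i s') (𝔇.fibreChartIso_hom_fst i s') 𝔓.polarization (𝔓.pol i) (𝔓.Ĝ i) (𝔓.hĜ i).snd.1
    (𝔓.pol_lam_left_comp_Ĝ i) ((hT i).2 Ω s')

/-- **The glued level structure is SYMPLECTIC-LIFTABLE for the glued polarisation if every chart level structure is
for the chart polarisation**: at `s = s′ ≫ (Uᵢ → S)` the symplectic lifts of `φᵢ` transport up along the chart square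
`(χᵢ, Ĝᵢ)` with its Poincaré clause and the section clause of FILE 4 `isBaseChangeVia_levelStructure` (§5).
[cite: Lan2013PELCompactifications, §1.3.6 Lemma 1.3.6.6 (pp. 81–82)] [cite: MumfordFogartyKirwan1994, Ch. 7 §2 Definition 7.2 (p. 129)] -/
theorem isSymplecticLiftable_levelStructure {g N : ℕ} (ℓ : 𝔇.LevelDatum g N) {δ : Fin g → ℕ}
    (h : ∀ i, (ℓ.φ i).IsSymplecticLiftable (𝔓.pol i) δ) :
    (𝔇.levelStructure ℓ).IsSymplecticLiftable 𝔓.polarization δ := by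
  intro Ω _ _ s Θ hΘ hΛ
  obtain ⟨i, s', rfl⟩ := 𝔇.exists_fac s
  obtain ⟨wG, wĜ, eP⟩ := 𝔓.poincare i
  exact 𝔇.abelianScheme.nonempty_symplecticLift_of_fibreIso (𝔇.A i) (𝔇.𝒰.f i) (𝔇.χ i) s'
    (𝔇.fibreChartIso i s') (𝔇.fibreChartIso_hom_fst i s') 𝔓.polarization (𝔓.pol i) (𝔓.Ĝ i)
    (𝔓.pol_lam_left_comp_Ĝ i) (𝔇.levelStructure ℓ) (ℓ.φ i) (𝔇.isBaseChangeVia_levelStructure ℓ i).2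
    wG wĜ eP (h i) Θ hΘ hΛ

end PolarizationDatum

end ZariskiGluingDatum

end AbelianSchemeOver

end Literature.AlgebraicGeometry.AbelianSchemes

end
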